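import Literature.Analysis.FluidPDE.AxisymmetricTypeIBounded
import Literature.Analysis.FluidPDE.ClassicalSuitable
import Literature.Analysis.FluidPDE.NSSerrinEstimates
import HarnessLib

/-!
# The standing hypotheses of `axisymmetric_typeI_bounded`: suitability below the final time and
# the integrability supplied by the Type I rate

Analysis/FluidPDE proofs-layer file (theorems only) on the decomposition path of
`Literature.Analysis.FluidPDE.knss_no_axisymmetric_typeI` through `axisymmetric_typeI_bounded`
(`KNSSTypeII.lean`) and its three local inputs (`AxisymmetricTypeIBounded.lean`), all stated over
the hypothesis structure `AxisymmetricTypeIHyp ν T u p` (classical on `[0, T)`, Leray–Hopf,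
bounded on the sub-slabs, axisymmetric, at most the Type I rate at `T`). The inputs are printed
for suitable weak / distributional solutions in backward cylinders whose top time is the final
time `T` (Seregin–Šverák 2009 Thm. 3.1; CKN ε-regularity). This file collects, once, what the
structure yields in that vocabulary:

* `AxisymmetricTypeIHyp.classical_Ioo`, `.momentum_timeDeriv` — the classical solution on the
  OPEN interval `(0, T)`, with the honest two-sided time derivative;
* `AxisymmetricTypeIHyp.isSuitableWeakSolutionOn` — `(u, p)` (original pressure) is a suitable
  weak solution, in the accepted local sense `IsSuitableWeakSolutionOn` (CKN 1982 (2.1)–(2.5),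
  Lin 1998 Def. 1), on EVERY open `Q ⊆ (0, T) × ℝ³`, by the accepted
  `isSuitableWeakSolutionOn_of_contDiffOn` (`ClassicalSuitable.lean`; local energy equality);
* `AxisymmetricTypeIHyp.eEnergy_le` — `∫ |u(t)|² ≤ 2E(u(0))` for `0 ≤ t < T` (energy inequality);
* `AxisymmetricTypeIHyp.exists_typeI_rate` — `√(T − t) |u(t, x)| ≤ C` on ALL of `[0, T) × ℝ³`
  (`IsTypeIBlowup.exists_sqrt_mul_norm_le`);
* `AxisymmetricTypeIHyp.lintegral_enorm_pow_three_le` and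
  `.lintegral_Ioo_lintegral_enorm_pow_three_lt_top` — `∫ |u(t)|³ ≤ C (T − t)^{-1/2} · 2E`, hence
  `u ∈ L³((0, T) × ℝ³)` (the hypothesis `v ∈ L³(Q)` of Seregin–Šverák 2009, Thm. 3.1, and the
  cubic quantity of the ε-regularity criteria, are finite on every cylinder below `T`).

The global (up to `t = T`) integrability of a PRESSURE is not available for the classical `p`
(determined only up to a function of time, which may blow up at `T`); it is obtained in the
sequel for the normalised pressure `p̃[u(t)]` (`tao_pressure_normalisation_holds`,
`eLpNorm_normalisedPressure_le_of_integrable`).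

## References

* G. Koch, N. Nadirashvili, G. Seregin, V. Šverák, Acta Math. 203 (2009), Thm. 6.2 (setting).
  [KochNadirashviliSereginSverak2009]
* G. Seregin, V. Šverák, Comm. PDE 34 (2009), Thm. 3.1 (hypotheses `v ∈ L³`, `q ∈ L^{3/2}`).
  [SereginSverak2009]
* L. Caffarelli, R. Kohn, L. Nirenberg, Comm. Pure Appl. Math. 35 (1982), §2 (2.1)–(2.5).
  [CaffarelliKohnNirenberg1982]
-/

noncomputable section

open MeasureTheory Set Function Filter Topology TopologicalSpace Metric
open scoped NNReal ENNReal Laplacian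

namespace Literature.Analysis.FluidPDE

/-- Local notation for physical space `ℝ³ = EuclideanSpace ℝ (Fin 3)`. -/
local notation "ℝ³" => EuclideanSpace ℝ (Fin 3)

namespace AxisymmetricTypeIHyp

variable {ν T : ℝ} {u : ℝ → ℝ³ → ℝ³} {p : ℝ → ℝ³ → ℝ}

/-! ### The classical solution on the open interval -/

/-- The classical solution restricted to the open time interval `(0, T)`. [folklore] -/
theorem classical_Ioo (H : AxisymmetricTypeIHyp ν T u p) :
    IsClassicalNSSolutionOn (Ioo 0 T) ν 0 u p :=
  H.classical.mono Ioo_subset_Ico_self isOpen_Ioo.uniqueDiffOn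

/-- On the open interval the one-sided time derivative within `(0, T)` is the two-sided one.
[folklore] -/
theorem timeDerivWithin_Ioo_eq {t : ℝ} (ht : t ∈ Ioo 0 T) (x : ℝ³) :
    timeDerivWithin (Ioo 0 T) u t x = timeDeriv u t x := by
  simp only [timeDerivWithin, timeDeriv]
  exact derivWithin_of_isOpen isOpen_Ioo ht

/-- **The momentum equation with the two-sided time derivative** on `(0, T) × ℝ³`. [folklore] -/
theorem momentum_timeDeriv (H : AxisymmetricTypeIHyp ν T u p) {t : ℝ} (ht : t ∈ Ioo 0 T)
    (x : ℝ³) :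
    timeDeriv u t x + convect (u t) (u t) x = ν • (Δ (u t)) x - gradient (p t) x + (0 : ℝ → ℝ³ → ℝ³) t x := by
  rw [← timeDerivWithin_Ioo_eq ht x]
  exact H.classical_Ioo.momentum t ht x

/-- **`(u, p)` is a suitable weak solution on every open region below the final time**
(accepted local notion `IsSuitableWeakSolutionOn`; CKN 1982 (2.1)–(2.5) with equality in (2.5)
for smooth solutions, by `isSuitableWeakSolutionOn_of_contDiffOn`). [cite: CaffarelliKohnNirenberg1982, §2 (2.1)–(2.5)] -/
theorem isSuitableWeakSolutionOn (H : AxisymmetricTypeIHyp ν T u p) (Q : Opens (ℝ × ℝ³))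
    (hQ : (Q : Set (ℝ × ℝ³)) ⊆ Ioo 0 T ×ˢ univ) : IsSuitableWeakSolutionOn Q ν 0 u p := by
  have hcl := H.classical_Ioo
  refine isSuitableWeakSolutionOn_of_contDiffOn isOpen_Ioo hQ
    (hcl.smooth_velocity.of_le (by norm_cast)) (hcl.smooth_pressure.of_le (by norm_cast)) ?_
    (fun t ht x => H.momentum_timeDeriv ht x) hcl.divFree
  exact continuousOn_const

/-- The distributional system on every open region below the final time (projection).
[cite: CaffarelliKohnNirenberg1982, §2 (2.2)] -/
theorem isDistributionalNSSolutionOn (H : AxisymmetricTypeIHyp ν T u p) (Q : Opens (ℝ × ℝ³))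
    (hQ : (Q : Set (ℝ × ℝ³)) ⊆ Ioo 0 T ×ˢ univ) : IsDistributionalNSSolutionOn Q ν 0 u p :=
  (H.isSuitableWeakSolutionOn Q hQ).distributional

/-! ### Energy and the Type I rate -/

/-- **The energy bound**: `∫ |u(t)|² ≤ 2 E(u(0))` for `0 ≤ t < T` (energy inequality of the
Leray–Hopf solution from `s = 0`). [folklore] -/
theorem eEnergy_le (H : AxisymmetricTypeIHyp ν T u p) {t : ℝ} (ht : t ∈ Ico 0 T) :
    eEnergy (u t) ≤ ENNReal.ofReal (2 * VectorCalculus.kineticEnergy (u 0)) := by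
  obtain ⟨G, -, -, hE, -⟩ := H.lerayHopf.weakGrad_energy
  have hE' : ∀ t ∈ Icc 0 T, VectorCalculus.kineticEnergy (u t) +
      ν * (∫⁻ τ in Ioo 0 t, ∫⁻ x, ENNReal.ofReal (frobeniusNormSq (G τ x))).toReal ≤
        VectorCalculus.kineticEnergy (u 0) := fun t ht => by simpa using hE t ht
  have ht' : t ∈ Icc 0 T := ⟨ht.1, ht.2.le⟩
  rw [eEnergy_eq_ofReal _ (H.lerayHopf.memLp t ht')]
  exact ENNReal.ofReal_le_ofReal
    (by linarith [kineticEnergy_le_of_energy_ineq H.viscosity_pos.le hE' ht'])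

/-- **The Type I rate on the whole interval**, with a nonnegative constant:
`√(T − t) |u(t, x)| ≤ C` for all `0 ≤ t < T` and all `x` (KNSS 2009, (assumption1)).
[cite: KochNadirashviliSereginSverak2009, Thm 6.2 (assumption1)] -/
theorem exists_typeI_rate (H : AxisymmetricTypeIHyp ν T u p) :
    ∃ C : ℝ, 0 ≤ C ∧ ∀ t ∈ Ico 0 T, ∀ x, Real.sqrt (T - t) * ‖u t x‖ ≤ C := by
  obtain ⟨C, hC⟩ := H.typeI.exists_sqrt_mul_norm_le H.bounded_subslab
  exact ⟨max C 0, le_max_right _ _, fun t ht x => (hC t ht x).trans (le_max_left _ _)⟩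

/-- Pointwise form of the rate: `|u(t, x)| ≤ C / √(T − t)` for `0 ≤ t < T`. [folklore] -/
theorem norm_le_div_sqrt {C t : ℝ} (hC : ∀ x, Real.sqrt (T - t) * ‖u t x‖ ≤ C) (ht : t < T)
    (x : ℝ³) : ‖u t x‖ ≤ C / Real.sqrt (T - t) := by
  have hpos : 0 < Real.sqrt (T - t) := Real.sqrt_pos.2 (sub_pos.2 ht)
  rw [le_div_iff₀ hpos, mul_comm]
  exact hC x

/-! ### `u ∈ L³` of the slab -/

/-- **Slice bound**: `∫ |u(t)|³ ≤ (C / √(T − t)) ∫ |u(t)|²` whenever `√(T − t)|u(t, ·)| ≤ C`.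
[folklore] -/
theorem lintegral_enorm_pow_three_le_of_rate {C t : ℝ}
    (hC : ∀ x, Real.sqrt (T - t) * ‖u t x‖ ≤ C) (ht : t < T) :
    ∫⁻ x, ‖u t x‖ₑ ^ (3 : ℕ) ≤ ENNReal.ofReal (C / Real.sqrt (T - t)) * eEnergy (u t) := by
  rw [eEnergy, ← lintegral_const_mul' _ _ ENNReal.ofReal_ne_top]
  refine lintegral_mono fun x => ?_
  have h1 : ‖u t x‖ₑ ≤ ENNReal.ofReal (C / Real.sqrt (T - t)) := by
    rw [← ofReal_norm]
    exact ENNReal.ofReal_le_ofReal (norm_le_div_sqrt hC ht x)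
  calc ‖u t x‖ₑ ^ (3 : ℕ) = ‖u t x‖ₑ * ‖u t x‖ₑ ^ 2 := by ring
    _ ≤ ENNReal.ofReal (C / Real.sqrt (T - t)) * ‖u t x‖ₑ ^ 2 := by gcongr

/-- **`u ∈ L³((0, T) × ℝ³)`** under the standing hypotheses: `∫₀ᵀ ∫ |u|³ ≤ 2E · C ∫₀ᵀ (T−t)^{-1/2} dt
< ∞` (the rate is integrable in time). [folklore] -/
theorem lintegral_Ioo_lintegral_enorm_pow_three_lt_top (H : AxisymmetricTypeIHyp ν T u p) :
    ∫⁻ t in Ioo 0 T, ∫⁻ x, ‖u t x‖ₑ ^ (3 : ℕ) < ∞ := by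
  obtain ⟨C, hC0, hC⟩ := H.exists_typeI_rate
  set E₀ : ℝ≥0∞ := ENNReal.ofReal (2 * VectorCalculus.kineticEnergy (u 0)) with hE₀
  -- slice bound for `0 < t < T`
  have hslice : ∀ t ∈ Ioo 0 T, ∫⁻ x, ‖u t x‖ₑ ^ (3 : ℕ) ≤
      ENNReal.ofReal (C * (T - t) ^ (-(1 / 2 : ℝ))) * E₀ := by
    intro t ht
    have hrate := lintegral_enorm_pow_three_le_of_rate (hC t ⟨ht.1.le, ht.2⟩) ht.2
    refine hrate.trans (mul_le_mul' (le_of_eq ?_) (H.eEnergy_le ⟨ht.1.le, ht.2⟩))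
    congr 1
    rw [Real.sqrt_eq_rpow, Real.rpow_neg (sub_pos.2 ht.2).le, div_eq_mul_inv]
  -- integrate the rate
  have hint : IntegrableOn (fun t : ℝ => C * (T - t) ^ (-(1 / 2 : ℝ))) (Ioo 0 T) := by
    have hr : (-1 : ℝ) < -(1 / 2 : ℝ) := by norm_num
    have h1 : IntervalIntegrable (fun s : ℝ => s ^ (-(1 / 2 : ℝ))) volume (T - T) (T - 0) :=
      intervalIntegral.intervalIntegrable_rpow' hr
    have h2 := (h1.comp_sub_left T)
    simp only [sub_zero, sub_self] at h2
    have h3 : IntegrableOn (fun t : ℝ => (T - t) ^ (-(1 / 2 : ℝ))) (Ioo 0 T) := by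
      rcases le_or_gt T 0 with hT | hT
      · rw [Ioo_eq_empty_of_le hT]; exact integrableOn_empty
      · have h4 : IntervalIntegrable (fun t : ℝ => (T - t) ^ (-(1 / 2 : ℝ))) volume 0 T := h2.symm
        exact (h4.1).mono_set Ioo_subset_Ioc_self
    exact h3.const_mul C
  have hnn : 0 ≤ᵐ[volume.restrict (Ioo 0 T)] fun t : ℝ => C * (T - t) ^ (-(1 / 2 : ℝ)) :=
    (ae_restrict_mem measurableSet_Ioo).mono fun t ht =>
      mul_nonneg hC0 (Real.rpow_nonneg (sub_pos.2 ht.2).le _)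
  calc ∫⁻ t in Ioo 0 T, ∫⁻ x, ‖u t x‖ₑ ^ (3 : ℕ)
      ≤ ∫⁻ t in Ioo 0 T, ENNReal.ofReal (C * (T - t) ^ (-(1 / 2 : ℝ))) * E₀ :=
        setLIntegral_mono' measurableSet_Ioo fun t ht => hslice t ht
    _ = (∫⁻ t in Ioo 0 T, ENNReal.ofReal (C * (T - t) ^ (-(1 / 2 : ℝ)))) * E₀ := by
        rw [lintegral_mul_const' _ _ ENNReal.ofReal_ne_top]
    _ < ∞ := by
        refine ENNReal.mul_lt_top ?_ ENNReal.ofReal_lt_top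
        rw [← ofReal_integral_eq_lintegral_ofReal hint hnn]
        exact ENNReal.ofReal_lt_top

end AxisymmetricTypeIHyp

end Literature.Analysis.FluidPDE

end
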